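import Mathlib
import Summits.KontsevichZagierPeriods.Zeta5Search.Certificates.RecordRayGrowthSharp
import Literature.NumberTheory.DiophantineGeometry.GelfondLemma
import HarnessLib

/-!
# ζ(5) search — Brown–Zudilin record ray: the LIMIT `lim log|Q(a·n)|/n` EXISTS (fam-brown8 g8)

HONEST FRAMING: systematic search; no irrationality claim unless certified. This file is about the size of the
integers `Q(a·n)` of [Brown–Zudilin 2022, (17), Sect. 11] (arXiv:2210.03391) on the record ray
`a = (8,16,10,15,12,16,18,13)`; nothing here bears on `ζ(5)`.

OUR work (Summit side). Certifier 2 (`Certificates/RecordRayGrowth{,Upper,Sharp}`) bounded `log|Q(a·n)|` on both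
sides for every `n` (`abs_recordQ_le`, `abs_recordQ_ge_sharp`) and showed that ANY limit of `log|Q(a·n)|/n` lies in the
closed printed bracket `[85.08768883, 85.08768884]` (`rate_mem_of_tendsto_sharp`) — but the EXISTENCE of the limit,
which is what the Literature FACT `BrownZudilin2022.record_rates` (second clause) asserts, was left open ("its existence
is not proved here"). This file proves it, with no recurrence and no analysis beyond Fekete's lemma:

* `zchoose_mul_le_add` — `C(N,K)·C(N',K') ≤ C(N+N',K+K')` (one term of Vandermonde), for the integer binomial `zchoose`;
* `qTerm_mul_le_add` — hence every summand of (17) is SUPERMULTIPLICATIVE along rays: the parameters of the seven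
  binomials are ℤ-linear in `(p,q,k₁,k₂)` with no constant term;
* `abs_recordQ_mul_le` — summing over the box: `|Q(a·n)|·|Q(a·m)| ≤ (15n+1)(8n+1)·|Q(a·(n+m))|`;
* `subadditive_uSeq` — so `u(n) = log(576 n²) − log|Q(a·n)|` (`u(0) = 0`) is subadditive, and it is bounded below
  per step by certifier 2's Chernoff bound; Fekete (`Subadditive.tendsto_lim`) gives the limit:
* **`tendsto_log_abs_recordQ_div`** — `log|Q(a·n)|/n → recordQRate`, an explicit real number, with
  **`growthEntSharp_le_recordQRate`** and **`recordQRate_le_growthSup`** (certifier 2's two constants: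
  `g(κ) = 85.0876888341… ≤ recordQRate ≤ A₀ = 85.0876888366…`).
The OPEN printed bracket `(85.08768883, 85.08768884)` (i.e. the second clause of `record_rates` verbatim) follows from the
strict numerical inequalities `85.08768883 < g(κ)`, `A₀ < 85.08768884`; it is derived in `Brown8/RecordQRateWindow.lean`.
-/

noncomputable section

open Finset Real Filter Topology

namespace Summit.KontsevichZagierPeriods.Zeta5Search.Brown8

open Summit.KontsevichZagierPeriods.Zeta5Search.BinomialSum
open Summit.KontsevichZagierPeriods.Zeta5Search.RecordRay
open Literature.NumberTheory.Irrationality.BrownZudilin2022 (zchoose Qcoeff)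

/-! ### Supermultiplicativity of binomials and of the summands of (17) -/

-- FILING-LANE edit (P2 g4): the local one-term Vandermonde lemma `choose_mul_choose_le_add` was a twin of the tree's
-- `Literature.NumberTheory.DiophantineGeometry.choose_mul_choose_le_choose_add` (GelfondLemma.lean; gate dedup.landed) —
-- deleted here and the tree lemma is used instead (import added).

/-- The same for the integer binomial `zchoose` of `BrownZudilin2022.GeneralFamily` (which is `0` off `0 ≤ K ≤ N`):
`zchoose N K · zchoose N' K' ≤ zchoose (N+N') (K+K')`. -/
theorem zchoose_mul_le_add (N N' K K' : ℤ) :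
    zchoose N K * zchoose N' K' ≤ zchoose (N + N') (K + K') := by
  by_cases h : 0 ≤ K ∧ K ≤ N
  · by_cases h' : 0 ≤ K' ∧ K' ≤ N'
    · obtain ⟨n, hn⟩ := Int.eq_ofNat_of_zero_le (h.1.trans h.2)
      obtain ⟨k, hk⟩ := Int.eq_ofNat_of_zero_le h.1
      obtain ⟨n', hn'⟩ := Int.eq_ofNat_of_zero_le (h'.1.trans h'.2)
      obtain ⟨k', hk'⟩ := Int.eq_ofNat_of_zero_le h'.1
      subst hn hk hn' hk'
      have hkn : k ≤ n := by exact_mod_cast h.2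
      have hkn' : k' ≤ n' := by exact_mod_cast h'.2
      rw [zchoose_cast_eq rfl rfl hkn, zchoose_cast_eq rfl rfl hkn',
        zchoose_cast_eq (n := n + n') (k := k + k') (by push_cast; ring) (by push_cast; ring) (by omega)]
      exact_mod_cast Literature.NumberTheory.DiophantineGeometry.choose_mul_choose_le_choose_add n n' k k'
    · rw [show zchoose N' K' = 0 by unfold zchoose; rw [if_neg h'], mul_zero]; exact zchoose_nonneg _ _
  · rw [show zchoose N K = 0 by unfold zchoose; rw [if_neg h], zero_mul]; exact zchoose_nonneg _ _

/-- Products of seven factorwise-supermultiplicative non-negative integers. -/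
private theorem mul7_mul7_le {a₁ a₂ a₃ a₄ a₅ a₆ a₇ b₁ b₂ b₃ b₄ b₅ b₆ b₇ c₁ c₂ c₃ c₄ c₅ c₆ c₇ : ℤ}
    (ha₁ : 0 ≤ a₁) (ha₂ : 0 ≤ a₂) (ha₃ : 0 ≤ a₃) (ha₄ : 0 ≤ a₄) (ha₅ : 0 ≤ a₅) (ha₆ : 0 ≤ a₆) (ha₇ : 0 ≤ a₇)
    (hb₁ : 0 ≤ b₁) (hb₂ : 0 ≤ b₂) (hb₃ : 0 ≤ b₃) (hb₄ : 0 ≤ b₄) (hb₅ : 0 ≤ b₅) (hb₆ : 0 ≤ b₆) (hb₇ : 0 ≤ b₇)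
    (hc₁ : 0 ≤ c₁) (hc₂ : 0 ≤ c₂) (hc₃ : 0 ≤ c₃) (hc₄ : 0 ≤ c₄) (hc₅ : 0 ≤ c₅) (hc₆ : 0 ≤ c₆)
    (h₁ : a₁ * b₁ ≤ c₁) (h₂ : a₂ * b₂ ≤ c₂) (h₃ : a₃ * b₃ ≤ c₃) (h₄ : a₄ * b₄ ≤ c₄) (h₅ : a₅ * b₅ ≤ c₅)
    (h₆ : a₆ * b₆ ≤ c₆) (h₇ : a₇ * b₇ ≤ c₇) :
    (a₁ * a₂ * a₃ * a₄ * a₅ * a₆ * a₇) * (b₁ * b₂ * b₃ * b₄ * b₅ * b₆ * b₇) ≤ c₁ * c₂ * c₃ * c₄ * c₅ * c₆ * c₇ := by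
  have e₁ : 0 ≤ a₁ * b₁ := mul_nonneg ha₁ hb₁
  have e₂ : 0 ≤ a₂ * b₂ := mul_nonneg ha₂ hb₂
  have e₃ : 0 ≤ a₃ * b₃ := mul_nonneg ha₃ hb₃
  have e₄ : 0 ≤ a₄ * b₄ := mul_nonneg ha₄ hb₄
  have e₅ : 0 ≤ a₅ * b₅ := mul_nonneg ha₅ hb₅
  have e₆ : 0 ≤ a₆ * b₆ := mul_nonneg ha₆ hb₆
  have e₇ : 0 ≤ a₇ * b₇ := mul_nonneg ha₇ hb₇
  calc (a₁ * a₂ * a₃ * a₄ * a₅ * a₆ * a₇) * (b₁ * b₂ * b₃ * b₄ * b₅ * b₆ * b₇)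
      = (a₁ * b₁) * (a₂ * b₂) * (a₃ * b₃) * (a₄ * b₄) * (a₅ * b₅) * (a₆ * b₆) * (a₇ * b₇) := by ring
    _ ≤ c₁ * c₂ * c₃ * c₄ * c₅ * c₆ * c₇ := by gcongr

/-- **The summands of (17) are supermultiplicative along rays**: for all parameter vectors `p, p'`, `q, q'` and all
indices, `qTerm p q k₁ k₂ · qTerm p' q' j₁ j₂ ≤ qTerm (p+p') (q+q') (k₁+j₁) (k₂+j₂)` (the arguments of the seven
binomials are ℤ-linear with no constant term). -/
theorem qTerm_mul_le_add (p p' : Fin 7 → ℤ) (q q' : Fin 5 → ℤ) (k₁ k₂ j₁ j₂ : ℤ) :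
    qTerm p q k₁ k₂ * qTerm p' q' j₁ j₂ ≤ qTerm (p + p') (q + q') (k₁ + j₁) (k₂ + j₂) := by
  unfold qTerm
  simp only [Pi.add_apply]
  have z := zchoose_nonneg
  have h₃ : zchoose (k₁ + k₂ + q 2 - p 0 - p 6) (p 3 + q 2 - p 0 - p 6)
      * zchoose (j₁ + j₂ + q' 2 - p' 0 - p' 6) (p' 3 + q' 2 - p' 0 - p' 6)
      ≤ zchoose (k₁ + j₁ + (k₂ + j₂) + (q 2 + q' 2) - (p 0 + p' 0) - (p 6 + p' 6))
        ((p 3 + p' 3) + (q 2 + q' 2) - (p 0 + p' 0) - (p 6 + p' 6)) := by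
    have h := zchoose_mul_le_add (k₁ + k₂ + q 2 - p 0 - p 6) (j₁ + j₂ + q' 2 - p' 0 - p' 6)
      (p 3 + q 2 - p 0 - p 6) (p' 3 + q' 2 - p' 0 - p' 6)
    rwa [show k₁ + k₂ + q 2 - p 0 - p 6 + (j₁ + j₂ + q' 2 - p' 0 - p' 6)
        = k₁ + j₁ + (k₂ + j₂) + (q 2 + q' 2) - (p 0 + p' 0) - (p 6 + p' 6) by ring,
      show p 3 + q 2 - p 0 - p 6 + (p' 3 + q' 2 - p' 0 - p' 6)
        = (p 3 + p' 3) + (q 2 + q' 2) - (p 0 + p' 0) - (p 6 + p' 6) by ring] at h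
  have h₄ : zchoose (q 0) (k₁ - p 1) * zchoose (q' 0) (j₁ - p' 1) ≤ zchoose (q 0 + q' 0) (k₁ + j₁ - (p 1 + p' 1)) := by
    have h := zchoose_mul_le_add (q 0) (q' 0) (k₁ - p 1) (j₁ - p' 1)
    rwa [show k₁ - p 1 + (j₁ - p' 1) = k₁ + j₁ - (p 1 + p' 1) by ring] at h
  have h₅ : zchoose (q 1) (k₁ - p 2) * zchoose (q' 1) (j₁ - p' 2) ≤ zchoose (q 1 + q' 1) (k₁ + j₁ - (p 2 + p' 2)) := by
    have h := zchoose_mul_le_add (q 1) (q' 1) (k₁ - p 2) (j₁ - p' 2)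
    rwa [show k₁ - p 2 + (j₁ - p' 2) = k₁ + j₁ - (p 2 + p' 2) by ring] at h
  have h₆ : zchoose (q 3) (k₂ - p 4) * zchoose (q' 3) (j₂ - p' 4) ≤ zchoose (q 3 + q' 3) (k₂ + j₂ - (p 4 + p' 4)) := by
    have h := zchoose_mul_le_add (q 3) (q' 3) (k₂ - p 4) (j₂ - p' 4)
    rwa [show k₂ - p 4 + (j₂ - p' 4) = k₂ + j₂ - (p 4 + p' 4) by ring] at h
  have h₇ : zchoose (q 4) (k₂ - p 5) * zchoose (q' 4) (j₂ - p' 5) ≤ zchoose (q 4 + q' 4) (k₂ + j₂ - (p 5 + p' 5)) := by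
    have h := zchoose_mul_le_add (q 4) (q' 4) (k₂ - p 5) (j₂ - p' 5)
    rwa [show k₂ - p 5 + (j₂ - p' 5) = k₂ + j₂ - (p 5 + p' 5) by ring] at h
  exact mul7_mul7_le (z _ _) (z _ _) (z _ _) (z _ _) (z _ _) (z _ _) (z _ _) (z _ _) (z _ _) (z _ _) (z _ _) (z _ _)
    (z _ _) (z _ _) (z _ _) (z _ _) (z _ _) (z _ _) (z _ _) (z _ _)
    (zchoose_mul_le_add _ _ _ _) (zchoose_mul_le_add _ _ _ _) h₃ h₄ h₅ h₆ h₇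

/-- `p(a·(n+m)) = p(a·n) + p(a·m)`. -/
theorem pRec_add (n m : ℕ) : pRec (n + m) = pRec n + pRec m := by
  ext i; fin_cases i <;> simp [pRec] <;> ring

/-- `q(a·(n+m)) = q(a·n) + q(a·m)`. -/
theorem qRec_add (n m : ℕ) : qRec (n + m) = qRec n + qRec m := by
  ext i; fin_cases i <;> simp [qRec] <;> ring

/-- Supermultiplicativity of the summands ON THE RECORD RAY (real form):
`t_n(k₁,k₂)·t_m(j₁,j₂) ≤ t_{n+m}(k₁+j₁, k₂+j₂)`. -/
theorem qTerm_ray_mul_le (n m : ℕ) (k₁ k₂ j₁ j₂ : ℤ) :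
    (qTerm (pRec n) (qRec n) k₁ k₂ : ℝ) * (qTerm (pRec m) (qRec m) j₁ j₂ : ℝ)
      ≤ (qTerm (pRec (n + m)) (qRec (n + m)) (k₁ + j₁) (k₂ + j₂) : ℝ) := by
  rw [pRec_add, qRec_add]
  exact_mod_cast qTerm_mul_le_add (pRec n) (pRec m) (qRec n) (qRec m) k₁ k₂ j₁ j₂

/-! ### The box sum: `|Q(a·n)|·|Q(a·m)| ≤ (15n+1)(8n+1)·|Q(a·(n+m))|` -/

/-- `|Q(a·n)|` as the box sum of its non-negative summands, with the box written out:
`k₁ ∈ [14n, 29n]`, `k₂ ∈ [18n, 26n]`. -/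
theorem abs_recordQ_eq_boxSum (n : ℕ) :
    |(recordQ n : ℝ)| = ∑ k₁ ∈ Icc (14 * (n : ℤ)) (29 * n), ∑ k₂ ∈ Icc (18 * (n : ℤ)) (26 * n),
      (qTerm (pRec n) (qRec n) k₁ k₂ : ℝ) := by
  rw [recordQ_eq_Qcoeff, abs_Qcoeff_eq_sum, pRec_1, qRec_0, pRec_4, qRec_3,
    show (14 : ℤ) * n + 15 * n = 29 * n by ring, show (18 : ℤ) * n + 8 * n = 26 * n by ring]

/-- Shifting a sum over an integer interval. -/
private theorem sum_Icc_shift (f : ℤ → ℝ) (a b c : ℤ) :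
    ∑ j ∈ Icc a b, f (c + j) = ∑ i ∈ Icc (c + a) (c + b), f i := by
  rw [← Finset.map_add_left_Icc, Finset.sum_map]; rfl

/-- For a fixed summand index `(k₁,k₂)` of the `n`-box: `t_n(k₁,k₂)·|Q(a·m)| ≤ |Q(a·(n+m))|`. -/
theorem qTerm_mul_abs_recordQ_le {n : ℕ} (m : ℕ) {k₁ k₂ : ℤ}
    (hk₁ : k₁ ∈ Icc (14 * (n : ℤ)) (29 * n)) (hk₂ : k₂ ∈ Icc (18 * (n : ℤ)) (26 * n)) :
    (qTerm (pRec n) (qRec n) k₁ k₂ : ℝ) * |(recordQ m : ℝ)| ≤ |(recordQ (n + m) : ℝ)| := by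
  rw [mem_Icc] at hk₁ hk₂
  rw [abs_recordQ_eq_boxSum m, abs_recordQ_eq_boxSum (n + m), Finset.mul_sum]
  have hnn : ∀ i₁ i₂ : ℤ, (0 : ℝ) ≤ (qTerm (pRec (n + m)) (qRec (n + m)) i₁ i₂ : ℝ) := fun i₁ i₂ => by
    exact_mod_cast qTerm_nonneg _ _ _ _
  calc ∑ j₁ ∈ Icc (14 * (m : ℤ)) (29 * m), (qTerm (pRec n) (qRec n) k₁ k₂ : ℝ)
          * ∑ j₂ ∈ Icc (18 * (m : ℤ)) (26 * m), (qTerm (pRec m) (qRec m) j₁ j₂ : ℝ)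
      ≤ ∑ j₁ ∈ Icc (14 * (m : ℤ)) (29 * m), ∑ j₂ ∈ Icc (18 * (m : ℤ)) (26 * m),
          (qTerm (pRec (n + m)) (qRec (n + m)) (k₁ + j₁) (k₂ + j₂) : ℝ) := by
        refine sum_le_sum fun j₁ _ => ?_
        rw [Finset.mul_sum]
        exact sum_le_sum fun j₂ _ => qTerm_ray_mul_le n m k₁ k₂ j₁ j₂
    _ = ∑ i₁ ∈ Icc (k₁ + 14 * (m : ℤ)) (k₁ + 29 * m), ∑ i₂ ∈ Icc (k₂ + 18 * (m : ℤ)) (k₂ + 26 * m),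
          (qTerm (pRec (n + m)) (qRec (n + m)) i₁ i₂ : ℝ) := by
        rw [← sum_Icc_shift (fun i₁ => ∑ i₂ ∈ Icc (k₂ + 18 * (m : ℤ)) (k₂ + 26 * m),
          (qTerm (pRec (n + m)) (qRec (n + m)) i₁ i₂ : ℝ))]
        refine sum_congr rfl fun j₁ _ => ?_
        rw [← sum_Icc_shift]
    _ ≤ ∑ i₁ ∈ Icc (k₁ + 14 * (m : ℤ)) (k₁ + 29 * m), ∑ i₂ ∈ Icc (18 * ((n + m : ℕ) : ℤ)) (26 * ((n + m : ℕ) : ℤ)),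
          (qTerm (pRec (n + m)) (qRec (n + m)) i₁ i₂ : ℝ) := by
        refine sum_le_sum fun i₁ _ => ?_
        refine sum_le_sum_of_subset_of_nonneg (Icc_subset_Icc ?_ ?_) fun i₂ _ _ => hnn i₁ i₂
        · push_cast; linarith [hk₂.1]
        · push_cast; linarith [hk₂.2]
    _ ≤ ∑ i₁ ∈ Icc (14 * ((n + m : ℕ) : ℤ)) (29 * ((n + m : ℕ) : ℤ)),
          ∑ i₂ ∈ Icc (18 * ((n + m : ℕ) : ℤ)) (26 * ((n + m : ℕ) : ℤ)),
          (qTerm (pRec (n + m)) (qRec (n + m)) i₁ i₂ : ℝ) := by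
        refine sum_le_sum_of_subset_of_nonneg (Icc_subset_Icc ?_ ?_) fun i₁ _ _ => sum_nonneg fun i₂ _ => hnn i₁ i₂
        · push_cast; linarith [hk₁.1]
        · push_cast; linarith [hk₁.2]

/-- **`|Q(a·n)|·|Q(a·m)| ≤ (15n+1)(8n+1)·|Q(a·(n+m))|`** (the number of summands of the `n`-box times the
supermultiplicativity of each summand). -/
theorem abs_recordQ_mul_le (n m : ℕ) :
    |(recordQ n : ℝ)| * |(recordQ m : ℝ)| ≤ (15 * (n : ℝ) + 1) * (8 * (n : ℝ) + 1) * |(recordQ (n + m) : ℝ)| := by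
  have hc1 : ((Icc (14 * (n : ℤ)) (29 * n)).card : ℝ) = 15 * (n : ℝ) + 1 := by
    rw [Int.card_Icc, show (29 : ℤ) * n + 1 - 14 * n = ((15 * n + 1 : ℕ) : ℤ) by push_cast; ring, Int.toNat_natCast]
    push_cast; ring
  have hc2 : ((Icc (18 * (n : ℤ)) (26 * n)).card : ℝ) = 8 * (n : ℝ) + 1 := by
    rw [Int.card_Icc, show (26 : ℤ) * n + 1 - 18 * n = ((8 * n + 1 : ℕ) : ℤ) by push_cast; ring, Int.toNat_natCast]
    push_cast; ring
  calc |(recordQ n : ℝ)| * |(recordQ m : ℝ)|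
      = ∑ k₁ ∈ Icc (14 * (n : ℤ)) (29 * n), ∑ k₂ ∈ Icc (18 * (n : ℤ)) (26 * n),
          (qTerm (pRec n) (qRec n) k₁ k₂ : ℝ) * |(recordQ m : ℝ)| := by
        rw [abs_recordQ_eq_boxSum n, Finset.sum_mul]
        exact sum_congr rfl fun _ _ => Finset.sum_mul _ _ _
    _ ≤ ∑ _k₁ ∈ Icc (14 * (n : ℤ)) (29 * n), ∑ _k₂ ∈ Icc (18 * (n : ℤ)) (26 * n), |(recordQ (n + m) : ℝ)| :=
        sum_le_sum fun k₁ hk₁ => sum_le_sum fun k₂ hk₂ => qTerm_mul_abs_recordQ_le m hk₁ hk₂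
    _ = (15 * (n : ℝ) + 1) * (8 * (n : ℝ) + 1) * |(recordQ (n + m) : ℝ)| := by
        rw [sum_const, sum_const, nsmul_eq_mul, nsmul_eq_mul, hc1, hc2]; ring

/-! ### Fekete -/

/-- The subadditive sequence `u(n) = log(576·n²) − log|Q(a·n)|` (`u(0) = 0`). -/
def uSeq (n : ℕ) : ℝ := if n = 0 then 0 else Real.log (576 * (n : ℝ) ^ 2) - Real.log |(recordQ n : ℝ)|

/-- `uSeq 0 = 0`. -/
@[simp] theorem uSeq_zero : uSeq 0 = 0 := by simp [uSeq]

/-- `uSeq n` for `n ≠ 0`. -/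
theorem uSeq_of_ne_zero {n : ℕ} (hn : n ≠ 0) :
    uSeq n = Real.log (576 * (n : ℝ) ^ 2) - Real.log |(recordQ n : ℝ)| := by simp [uSeq, hn]

/-- The multiplicative form of subadditivity: for `1 ≤ m ≤ n`,
`|Q(a·m)|·|Q(a·n)|·576(m+n)² ≤ |Q(a·(m+n))|·(576 m²)·(576 n²)`. -/
theorem abs_recordQ_mul_le_sq {m n : ℕ} (hm : 1 ≤ m) (hmn : m ≤ n) :
    |(recordQ m : ℝ)| * |(recordQ n : ℝ)| * (576 * ((m : ℝ) + n) ^ 2)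
      ≤ |(recordQ (m + n) : ℝ)| * (576 * (m : ℝ) ^ 2) * (576 * (n : ℝ) ^ 2) := by
  have hT := abs_recordQ_mul_le m n
  have hm' : (1 : ℝ) ≤ m := by exact_mod_cast hm
  have hmn' : (m : ℝ) ≤ n := by exact_mod_cast hmn
  have hQ : 0 ≤ |(recordQ (m + n) : ℝ)| := abs_nonneg _
  have p1 : (15 * (m : ℝ) + 1) * (8 * (m : ℝ) + 1) ≤ 144 * (m : ℝ) ^ 2 := by nlinarith
  have p2 : ((m : ℝ) + n) ^ 2 ≤ 4 * (n : ℝ) ^ 2 := by nlinarith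
  have A : (15 * (m : ℝ) + 1) * (8 * (m : ℝ) + 1) * ((m : ℝ) + n) ^ 2 ≤ 144 * (m : ℝ) ^ 2 * (4 * (n : ℝ) ^ 2) :=
    mul_le_mul p1 p2 (by positivity) (by positivity)
  calc |(recordQ m : ℝ)| * |(recordQ n : ℝ)| * (576 * ((m : ℝ) + n) ^ 2)
      = (|(recordQ m : ℝ)| * |(recordQ n : ℝ)|) * ((m : ℝ) + n) ^ 2 * 576 := by ring
    _ ≤ ((15 * (m : ℝ) + 1) * (8 * (m : ℝ) + 1) * |(recordQ (m + n) : ℝ)|) * ((m : ℝ) + n) ^ 2 * 576 := by gcongr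
    _ = |(recordQ (m + n) : ℝ)| * ((15 * (m : ℝ) + 1) * (8 * (m : ℝ) + 1) * ((m : ℝ) + n) ^ 2) * 576 := by ring
    _ ≤ |(recordQ (m + n) : ℝ)| * (144 * (m : ℝ) ^ 2 * (4 * (n : ℝ) ^ 2)) * 576 := by gcongr
    _ = |(recordQ (m + n) : ℝ)| * (576 * (m : ℝ) ^ 2) * (576 * (n : ℝ) ^ 2) := by ring

/-- Subadditivity for `1 ≤ m ≤ n`. -/
private theorem uSeq_add_le_of_le {m n : ℕ} (hm : 1 ≤ m) (hmn : m ≤ n) : uSeq (m + n) ≤ uSeq m + uSeq n := by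
  have hn : 1 ≤ n := hm.trans hmn
  rw [uSeq_of_ne_zero (by omega), uSeq_of_ne_zero (by omega), uSeq_of_ne_zero (by omega)]
  have qm := abs_recordQ_pos m
  have qn := abs_recordQ_pos n
  have qmn := abs_recordQ_pos (m + n)
  have hm' : (0 : ℝ) < m := by exact_mod_cast hm
  have hn' : (0 : ℝ) < n := by exact_mod_cast hn
  have key := Real.log_le_log (by positivity) (abs_recordQ_mul_le_sq hm hmn)
  have e1 : Real.log (|(recordQ m : ℝ)| * |(recordQ n : ℝ)| * (576 * ((m : ℝ) + n) ^ 2))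
      = Real.log |(recordQ m : ℝ)| + Real.log |(recordQ n : ℝ)| + Real.log (576 * ((m : ℝ) + n) ^ 2) := by
    rw [Real.log_mul (by positivity) (by positivity), Real.log_mul (by positivity) (by positivity)]
  have e2 : Real.log (|(recordQ (m + n) : ℝ)| * (576 * (m : ℝ) ^ 2) * (576 * (n : ℝ) ^ 2))
      = Real.log |(recordQ (m + n) : ℝ)| + Real.log (576 * (m : ℝ) ^ 2) + Real.log (576 * (n : ℝ) ^ 2) := by
    rw [Real.log_mul (by positivity) (by positivity), Real.log_mul (by positivity) (by positivity)]
  rw [e1, e2] at key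
  push_cast
  linarith

/-- **`u` is subadditive.** -/
theorem subadditive_uSeq : Subadditive uSeq := by
  intro m n
  rcases Nat.eq_zero_or_pos m with hm | hm
  · subst hm; simp
  rcases Nat.eq_zero_or_pos n with hn | hn
  · subst hn; simp
  rcases le_total m n with hmn | hnm
  · exact uSeq_add_le_of_le hm hmn
  · rw [add_comm m n, add_comm (uSeq m)]
    exact uSeq_add_le_of_le hn hnm

/-- Per-step upper bound from certifier 2's Chernoff bound: `log|Q(a·n)| ≤ (23 + A₀)·n`. -/
theorem log_abs_recordQ_le (n : ℕ) : Real.log |(recordQ n : ℝ)| ≤ (23 + growthSup) * n := by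
  have h := Real.log_le_log (abs_recordQ_pos n) (abs_recordQ_le n)
  have hn : (0 : ℝ) ≤ n := Nat.cast_nonneg n
  rw [Real.log_mul (by positivity) (by positivity), Real.log_mul (by positivity) (by positivity), Real.log_exp] at h
  have h15 : Real.log (15 * (n : ℝ) + 1) ≤ 15 * n := by
    have := Real.log_le_sub_one_of_pos (show (0 : ℝ) < 15 * n + 1 by positivity); linarith
  have h8 : Real.log (8 * (n : ℝ) + 1) ≤ 8 * n := by
    have := Real.log_le_sub_one_of_pos (show (0 : ℝ) < 8 * n + 1 by positivity); linarith
  linarith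

/-- `u(n)/n` is bounded below (by `−(23 + A₀)` and `0`). -/
theorem bddBelow_uSeq_div : BddBelow (Set.range fun n : ℕ => uSeq n / n) := by
  refine ⟨min 0 (-(23 + growthSup)), ?_⟩
  rintro _ ⟨n, rfl⟩
  dsimp only
  rcases Nat.eq_zero_or_pos n with hn | hn
  · subst hn; simp
  have hn' : (0 : ℝ) < n := by exact_mod_cast hn
  have h1 : (1 : ℝ) ≤ 576 * (n : ℝ) ^ 2 := by
    have : (1 : ℝ) ≤ n := by exact_mod_cast hn
    nlinarith
  have hlog : 0 ≤ Real.log (576 * (n : ℝ) ^ 2) := Real.log_nonneg h1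
  have hQ := log_abs_recordQ_le n
  refine (min_le_right _ _).trans ?_
  rw [uSeq_of_ne_zero hn.ne', le_div_iff₀ hn']
  linarith

/-- **The rate**: `recordQRate = lim log|Q(a·n)|/n` (defined through Fekete's limit of `u`). -/
def recordQRate : ℝ := -subadditive_uSeq.lim

/-- `log(576·n²)/n → 0`. -/
private theorem tendsto_log_sq_div : Tendsto (fun n : ℕ => Real.log (576 * (n : ℝ) ^ 2) / n) atTop (𝓝 0) := by
  have h1 : Tendsto (fun n : ℕ => Real.log (n : ℝ) / (n : ℝ)) atTop (𝓝 0) :=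
    (Real.isLittleO_log_id_atTop.tendsto_div_nhds_zero).comp tendsto_natCast_atTop_atTop
  have h2 : Tendsto (fun n : ℕ => Real.log 576 / (n : ℝ)) atTop (𝓝 0) := tendsto_const_div_atTop_nhds_zero_nat _
  have h := h2.add (h1.const_mul 2)
  rw [zero_add, mul_zero] at h
  refine h.congr' ?_
  filter_upwards [eventually_ge_atTop 1] with n hn
  have hn' : (0 : ℝ) < n := by exact_mod_cast hn
  rw [Real.log_mul (by norm_num) (by positivity), Real.log_pow]
  push_cast
  field_simp

/-- **THE LIMIT EXISTS: `log|Q(a·n)|/n → recordQRate`.** -/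
theorem tendsto_log_abs_recordQ_div :
    Tendsto (fun n : ℕ => Real.log |(recordQ n : ℝ)| / n) atTop (𝓝 recordQRate) := by
  have hF := subadditive_uSeq.tendsto_lim bddBelow_uSeq_div
  have h := tendsto_log_sq_div.sub hF
  rw [zero_sub] at h
  refine h.congr' ?_
  filter_upwards [eventually_ge_atTop 1] with n hn
  rw [uSeq_of_ne_zero (by omega)]
  ring

/-- **Lower end: `g(κ) ≤ recordQRate`** (`g(κ) = growthEntSharp = 85.0876888341…`, certifier 2's sharp lattice term). -/
theorem growthEntSharp_le_recordQRate : growthEntSharp ≤ recordQRate := by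
  refine le_of_forall_pos_le_add fun ε hε => ?_
  have hev : ∀ᶠ n : ℕ in atTop, growthEntSharp - ε ≤ Real.log |(recordQ n : ℝ)| / n := by
    filter_upwards [eventually_log_linear_le (a := 31) (b := 0) (by norm_num) le_rfl (show (0 : ℝ) < ε / 175 by positivity),
      eventually_ge_atTop 1, tendsto_natCast_atTop_atTop.eventually_ge_atTop (196 / ε)] with n h31 hn1 hn2
    have hlow := abs_recordQ_ge_sharp hn1
    have hnpos : (0 : ℝ) < n := by exact_mod_cast hn1
    rw [add_zero] at h31
    have h98 : (98 : ℝ) ≤ ε / 2 * n := by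
      rw [div_le_iff₀ hε] at hn2; nlinarith
    rw [le_div_iff₀ hnpos]
    nlinarith
  have := ge_of_tendsto tendsto_log_abs_recordQ_div hev
  linarith

/-- **Upper end: `recordQRate ≤ A₀`** (`A₀ = growthSup = 85.0876888366…`, certifier 2's Chernoff constant). -/
theorem recordQRate_le_growthSup : recordQRate ≤ growthSup := by
  refine le_of_forall_pos_le_add fun ε hε => ?_
  have hev : ∀ᶠ n : ℕ in atTop, Real.log |(recordQ n : ℝ)| / n ≤ growthSup + ε := by
    filter_upwards [eventually_log_linear_le (a := 15) (b := 1) (by norm_num) (by norm_num) (half_pos hε),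
      eventually_log_linear_le (a := 8) (b := 1) (by norm_num) (by norm_num) (half_pos hε),
      eventually_ge_atTop 1] with n h15 h8 hn1
    have hnpos : (0 : ℝ) < n := by exact_mod_cast hn1
    have h := Real.log_le_log (abs_recordQ_pos n) (abs_recordQ_le n)
    rw [Real.log_mul (by positivity) (by positivity), Real.log_mul (by positivity) (by positivity), Real.log_exp] at h
    rw [div_le_iff₀ hnpos]
    nlinarith
  exact le_of_tendsto tendsto_log_abs_recordQ_div hev

/-- The rate lies in certifier 2's CLOSED printed bracket `[85.08768883, 85.08768884]` (now about an existing limit). -/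
theorem recordQRate_mem_Icc : recordQRate ∈ Set.Icc (8508768883 / 10 ^ 8 : ℝ) (8508768884 / 10 ^ 8) :=
  ⟨growthEntSharp_ge.trans growthEntSharp_le_recordQRate, recordQRate_le_growthSup.trans growthSup_le⟩

end Summit.KontsevichZagierPeriods.Zeta5Search.Brown8
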